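import Summits.BirchSwinnertonDyer.Rank1Residual.P2.CMKolyvaginSelmerDescentAtTwo
import Summits.BirchSwinnertonDyer.Rank1Residual.P2.CMKolyvaginTamagawaSelmerAtTwo
import Summits.BirchSwinnertonDyer.BirchSwinnertonDyer.Theorems.CMKolyvaginAtInertTwoTranspositionAtTwo
import Literature.NumberTheory.EllipticCurves.SelmerTorsionExactDescentProofs
import Literature.NumberTheory.Automorphic.QuadraticBaseChangeFrobCompatibleAuxFieldProofs
import Literature.NumberTheory.QuadraticFields.SquareRootGenerator
import HarnessLib

/-!
# `P2` typed interface (cell `bsd-print-cf2`, seat ty2): EXACT LOCAL DESCENT of the `2^M`-Selmer condition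
# along `L = K(√d_F) ⊃ K` on the habitat of `CMKolyvaginExactAtInertTwo`, and MEMO stub S2's output
# `#Sel_{2^M}(E_L/L) = (#Sel_{2^M}(E_K/K))²` modulo ONE local binder at the places above `p_F`

Route `CMKolyvaginAtInertTwo`, crux `CMKolyvaginExactAtInertTwo` (stmt-BirchSwinnertonDyer-24277); MEMO
`Cruxes/CMExactDescentAtTwo/MEMO-inert-order-splitting.md` §5/§6 stub **S2** (descent `L → K_H` and its
image). Sequel of `CMKolyvaginSelmerDescentAtTwo` (p660127: the count GRANTED `hdesc`) and of the Literature
dischargers `SelmerTorsionExactDescentProofs` (p660842). THEOREMS ONLY (0 defs / 0 facts / 0 sorry); no item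
is closed; BSD is not proved by this.

§1 GENERIC (`E = W/K` elliptic over a totally complex number field `K`; `L = K(θ)`, `[L : K] = 2`,
`θ ∉ K`, `θ² = d ∈ ℤ`, `d ≡ 1 (mod 4)`; any level `n`):
`mem_selmerGroup_of_resTorsion_mem_of_sq_eq_intCast` — **`res x ∈ Sel^(n)(E_L/L) ⟹ x ∈ Sel^(n)(E/K)`**
provided (a) at the finite places `v ∤ d`: `gcd(n, c_v(E)) = 1` — these places are unramified in `L`
(`isUnramifiedIn_of_sq_eq_intCast`) and Milne ADT I.3.8 in Tamagawa form (the tree's theorem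
`MilneTamagawa.Milne2006_localTamagawaNumber_smul_unramifiedClass_eq_zero_holds`) kills the local term on
classes of order prime to `c_v` (`mem_localRestrictionKer_adicCompletion_of_isUnramifiedIn_of_isCoprime`);
(b) at the finite places `v ∣ d`, at some `w ∣ v`: `E(K̄_v)^{Γ_{L̃_w}}` is uniquely `n`-divisible
(`mem_localRestrictionKer_adicCompletion_of_fixedPoints_divisible`) — the displayed binder `hram`.

§2 THE HABITAT (`E = W/ℚ` with CM, `2` inert in `F = ℚ(√d_F)`, `∏ c_p` odd; `K` imaginary quadratic with
the Heegner hypothesis for `N_E`; `L ⊇ K`, `[L : K] = 2`, `θ ∈ L ∖ K`, `θ² = d_F`, i.e. `L = K·F`):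
* `mem_selmerGroup_baseChange_of_resTorsion_mem` — **`hdesc` at every level `2^M` modulo `hram` at the
  places of `K` above `p_F = −d_F`**: `d_F ∈ {−3, −11, −19, −43, −67, −163}` is `≡ 1 (mod 4)`
  (`cmFieldDiscrOfJ_mem_of_cmInert_two`), and every `c_v(E_K)` is odd (ty2 g23's
  `TamagawaSelmerAtTwo.odd_localTamagawaNumber_baseChange_of_isImaginaryQuadratic`).
* `natCard_selmer_baseChange_tower_eq_sq_of_sq_eq_cmFieldDiscr` — **`#Sel_{2^M}(E_L/L) = (#Sel_{2^M}(E_K/K))²`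
  modulo `hram`**, from `natCard_selmer_baseChange_tower_eq_sq_of_descent` (p660127): the involution
  `σ ∈ Gal(L/K)` (`σ θ = −θ`), the square root `r = θ·s` of `Δ_E = d_F s²`
  (`KolyvaginFrobeniusTwo.exists_Δ_eq_cmFieldDiscr_mul_sq_of_cmInert_two`) and `θ ∉ K`
  (`KolyvaginImageTwo.not_isSquare_algebraMap_Δ_of_cmInert_two_of_heegner`) are all DERIVED here, so the
  statement carries the habitat hypotheses, `θ² = d_F`, `[L : K] = 2`, and the one binder `hram`.

What `hram` asks at `v ∣ p_F` (for the next seat): with `w ∣ v` the place of `L`, every point of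
`E(K̄_v)` fixed by `Γ_{L̃_w}` (`finGalSubgroup`, i.e. every point of `E(L̃_w)`, `L̃_w ≅ L_w = K_v(√d_F)`)
killed by `2^M` is `0`, and every such point is `2^M` times such a point — i.e. `E(L_w)[2] = 0` and Milne
I.3.3 at `w ∤ 2`; and `E(L_w)[2] = 0 ⟸ E(K_v)[2] = E(ℚ_{p_F})[2] = 0 ⟸ c_{p_F}` odd with additive reduction
(`natCard_torsion_dvd_index_mul_natCard_reduction`). MEMO §3 (a)'s «p_F-defect» is this binder.

beyond-print theorem: NO (Dokchitser–Dokchitser 2010, proof of Lemma 4.14; Milne ADT I.3.8; Serre GC I §2.6 (b)).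
BSD is not proved by any of this; no summit statement is proved by this seat.

References: [DokchitserDokchitserAnnals2010] Lemma 4.14 (proof); [MilneADT2006] Ch. I Prop. 3.8, Lemma 3.3;
[SerreGaloisCohomology1997] I §2.6 (b); [GrossLMS1991] §1, §6; [Lang1987] Ch. 10 §4; [NeukirchANT1999] Ch. I §8.
-/

set_option autoImplicit false

noncomputable section

open scoped Classical

namespace Summit.BirchSwinnertonDyer.Rank1Residual.P2.SelmerDescentAtTwo

open WeierstrassCurve Field NumberField
open IsDedekindDomain (HeightOneSpectrum)
open Literature.NumberTheory.EllipticCurves Literature.NumberTheory.EllipticCurves.Rank1Residual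
open Literature.NumberTheory.GaloisRepresentations
open Summit.BirchSwinnertonDyer.BirchSwinnertonDyer.Theorems

/-! ## §1 Generic: exact descent of the `n`-Selmer condition along `K(√d)/K`, `d ≡ 1 (mod 4)` -/

section Generic

variable {K L : Type} [Field K] [NumberField K] [Field L] [NumberField L] [Algebra K L]
variable (W : WeierstrassCurve K) [W.IsElliptic]

variable (L) in
/-- **Exact local descent of the `n`-Selmer condition along `L = K(θ) ⊃ K`, `θ² = d ≡ 1 (mod 4)`,
modulo unique divisibility at the places dividing `d`.** `K` totally complex, `E = W/K` elliptic,
`[L : K] = 2`, `θ ∈ L ∖ K`, `θ² = d`, `d = 4k + 1`; (a) at the finite `v` with `d ∉ v`: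
`gcd(n, c_v(E)) = 1`; (b) at the finite `v` with `d ∈ v`, at some `w ∣ v`: `E(K̄_v)^{Γ_{L̃_w}}` has no
`n`-torsion and is `n`-divisible. Then `res x ∈ Sel^(n)(E_L/L) ⟹ x ∈ Sel^(n)(E/K)`. The places (a) are
unramified in `L` (`isUnramifiedIn_of_sq_eq_intCast`), where Milne ADT I.3.8 (Tamagawa form, the tree's
theorem `Milne2006_localTamagawaNumber_smul_unramifiedClass_eq_zero_holds`) gives
`mem_localRestrictionKer_adicCompletion_of_isUnramifiedIn_of_isCoprime`; the places (b) are
`mem_localRestrictionKer_adicCompletion_of_fixedPoints_divisible`; assembly by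
`mem_selmerGroup_of_resTorsion_mem_of_forall`. [cite: DokchitserDokchitserAnnals2010, Lemma 4.14 (proof)]
[cite: MilneADT2006, Ch. I Prop. 3.8] [cite: NeukirchANT1999, Ch. I §8] -/
theorem mem_selmerGroup_of_resTorsion_mem_of_sq_eq_intCast (hK : ∀ v : InfinitePlace K, v.IsComplex)
    (hLK : Module.finrank K L = 2) {θ : L} (hθK : θ ∉ Set.range (algebraMap K L)) {d k : ℤ}
    (hdk : d = 4 * k + 1) (hθ : θ ^ 2 = (d : L)) {n : ℤ}
    (hcop : ∀ v : HeightOneSpectrum (𝓞 K), ((d : 𝓞 K)) ∉ v.asIdeal →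
      IsCoprime n
        ((W.baseChange (v.adicCompletion K)).localTamagawaNumber (v.adicCompletionIntegers K) : ℤ))
    (hram : ∀ v : HeightOneSpectrum (𝓞 K), ((d : 𝓞 K)) ∈ v.asIdeal →
      ∃ (w : HeightOneSpectrum (𝓞 L)) (_ : w.asIdeal.LiesOver v.asIdeal),
        letI : Algebra (v.adicCompletion K) (w.adicCompletion L) :=
          (adicCompletionMap (K := K) L v w).toAlgebra
        (∀ a : localPoints W (v.adicCompletion K),
          (∀ g ∈ finGalSubgroup (E := v.adicCompletion K) (w.adicCompletion L), g • a = a) →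
            n • a = 0 → a = 0) ∧
        (∀ a : localPoints W (v.adicCompletion K),
          (∀ g ∈ finGalSubgroup (E := v.adicCompletion K) (w.adicCompletion L), g • a = a) →
            ∃ b : localPoints W (v.adicCompletion K),
              (∀ g ∈ finGalSubgroup (E := v.adicCompletion K) (w.adicCompletion L), g • b = b) ∧
                n • b = a))
    {x : galH1Torsion W n} (hx : resTorsion W L n x ∈ selmerGroup (W.baseChange L) n) :
    x ∈ selmerGroup W n := by
  haveI : FiniteDimensional K L := Module.finite_of_finrank_pos (by rw [hLK]; exact two_pos)
  haveI : Algebra.IsQuadraticExtension K L := ⟨hLK⟩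
  haveI : IsGalois K L := inferInstance
  have hL : ∀ y : L, ∃ a b : K, y = algebraMap K L a + algebraMap K L b * θ :=
    Literature.NumberTheory.QuadraticFields.Quadratic.exists_eq_add_mul hLK hθK
  have hθ' : θ ^ 2 = algebraMap K L (d : K) := by rw [hθ, map_intCast]
  refine mem_selmerGroup_of_resTorsion_mem_of_forall W L n hK (fun v ↦ ?_) hx
  by_cases hv : ((d : 𝓞 K)) ∈ v.asIdeal
  · obtain ⟨w, hw, htf, hdiv⟩ := hram v hv
    exact ⟨w, hw, fun hx' ↦ mem_localRestrictionKer_adicCompletion_of_fixedPoints_divisible W L w htf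
      hdiv (zsmul_torsionH1ToH1_eq_zero W n x) hx'⟩
  · obtain ⟨w, hw⟩ := exists_liesOver L v
    haveI := hw
    have hunr : Algebra.IsUnramifiedIn (𝓞 L) v.asIdeal := by
      refine isUnramifiedIn_of_sq_eq_intCast L hLK hθK hdk hθ v fun 𝔓 h𝔓 hd𝔓 ↦ hv ?_
      have h4 : 𝔓.comap (algebraMap (𝓞 K) (absIntegers (𝓞 K) K)) = v.asIdeal := h𝔓.2.over.symm
      rw [← h4, Ideal.mem_comap, map_intCast]
      exact hd𝔓
    exact ⟨w, hw, fun hx' ↦ mem_localRestrictionKer_adicCompletion_of_isUnramifiedIn_of_isCoprime W L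
      MilneTamagawa.Milne2006_localTamagawaNumber_smul_unramifiedClass_eq_zero_holds hθ' hL hunr w
      (hcop v hv) (zsmul_torsionH1ToH1_eq_zero W n x) hx'⟩

end Generic

/-! ## §2 The habitat: `E/ℚ` with CM, `2` inert in `F`, `∏ c_p` odd; `K` Heegner; `L = K(√d_F)` -/

section Habitat

variable (W : WeierstrassCurve ℚ) [W.IsElliptic]
variable {K L : Type} [Field K] [NumberField K] [Field L] [NumberField L] [Algebra K L]

/-- `d_F ≡ 1 (mod 4)` on the habitat: `CMInert W 2` pins `d_F ∈ {−3, −11, −19, −43, −67, −163}`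
(`cmFieldDiscrOfJ_mem_of_cmInert_two`). [cite: SilvermanATAEC1994, App. A §3] -/
theorem exists_cmFieldDiscrOfJ_eq_four_mul_add_one (hin : CMInert W 2) :
    ∃ k : ℤ, cmFieldDiscrOfJ W.j = 4 * k + 1 := by
  rcases cmFieldDiscrOfJ_mem_of_cmInert_two W hin with h | h | h | h | h | h <;> rw [h]
  exacts [⟨-1, by norm_num⟩, ⟨-3, by norm_num⟩, ⟨-5, by norm_num⟩, ⟨-11, by norm_num⟩, ⟨-17, by norm_num⟩,
    ⟨-41, by norm_num⟩]

/-- **EXACT LOCAL DESCENT ON THE HABITAT, modulo the places above `p_F`.** For `E = W/ℚ` with CM, `2`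
inert in `F`, `∏_p c_p(E)` odd; `K` imaginary quadratic with the Heegner hypothesis for `N_E`; `L ⊇ K`
with `[L : K] = 2` and `θ ∈ L ∖ K`, `θ² = d_F` (so `L = K·F`): at every level `2^M`,
**`res x ∈ Sel_{2^M}(E_L/L) ⟹ x ∈ Sel_{2^M}(E_K/K)`** provided, at each place `v` of `K` above `p_F`
(`d_F ∈ v`), some `w ∣ v` has `E(K̄_v)^{Γ_{L̃_w}}` uniquely `2^M`-divisible (`hram`). Every `c_v(E_K)`
is odd (`odd_localTamagawaNumber_baseChange_of_isImaginaryQuadratic`) and `d_F ≡ 1 (mod 4)`, so §1 applies.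
[cite: DokchitserDokchitserAnnals2010, Lemma 4.14 (proof)] [cite: GrossLMS1991, §1 and §6 Prop. 6.2 (1)]
[cite: MilneADT2006, Ch. I Prop. 3.8] -/
theorem mem_selmerGroup_baseChange_of_resTorsion_mem (hin : CMInert W 2) (hodd : Odd W.tamagawaProduct)
    (hK : IsImaginaryQuadratic K) (hH : SatisfiesHeegnerHypothesis (W.conductorNorm ℤ) K)
    (hLK : Module.finrank K L = 2) {θ : L} (hθ : θ ^ 2 = algebraMap ℚ L (cmFieldDiscrOfJ W.j))
    (hθK : θ ∉ Set.range (algebraMap K L)) (M : ℕ)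
    (hram : ∀ v : HeightOneSpectrum (𝓞 K), ((cmFieldDiscrOfJ W.j : 𝓞 K)) ∈ v.asIdeal →
      ∃ (w : HeightOneSpectrum (𝓞 L)) (_ : w.asIdeal.LiesOver v.asIdeal),
        letI : Algebra (v.adicCompletion K) (w.adicCompletion L) :=
          (adicCompletionMap (K := K) L v w).toAlgebra
        (∀ a : localPoints (W.baseChange K) (v.adicCompletion K),
          (∀ g ∈ finGalSubgroup (E := v.adicCompletion K) (w.adicCompletion L), g • a = a) →
            ((2 : ℤ) ^ M) • a = 0 → a = 0) ∧
        (∀ a : localPoints (W.baseChange K) (v.adicCompletion K),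
          (∀ g ∈ finGalSubgroup (E := v.adicCompletion K) (w.adicCompletion L), g • a = a) →
            ∃ b : localPoints (W.baseChange K) (v.adicCompletion K),
              (∀ g ∈ finGalSubgroup (E := v.adicCompletion K) (w.adicCompletion L), g • b = b) ∧
                ((2 : ℤ) ^ M) • b = a))
    {x : galH1Torsion (W.baseChange K) ((2 : ℤ) ^ M)}
    (hx : resTorsion (W.baseChange K) L ((2 : ℤ) ^ M) x ∈
      selmerGroup ((W.baseChange K).baseChange L) ((2 : ℤ) ^ M)) :
    x ∈ selmerGroup (W.baseChange K) ((2 : ℤ) ^ M) := by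
  haveI : (W.baseChange K).IsElliptic := by rw [baseChange]; infer_instance
  obtain ⟨k, hk⟩ := exists_cmFieldDiscrOfJ_eq_four_mul_add_one W hin
  have hθ' : θ ^ 2 = ((cmFieldDiscrOfJ W.j : ℤ) : L) := by rw [hθ, map_intCast]
  refine mem_selmerGroup_of_resTorsion_mem_of_sq_eq_intCast L (W.baseChange K) hK.2.isComplex hLK hθK hk
    hθ' (fun v _ ↦ ?_) hram hx
  have h := TamagawaSelmerAtTwo.isCoprime_two_pow_of_odd
    (TamagawaSelmerAtTwo.odd_localTamagawaNumber_baseChange_of_isImaginaryQuadratic W K hodd hK hH v) M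
  rwa [Nat.cast_pow, Nat.cast_ofNat] at h

omit [W.IsElliptic] [NumberField K] [NumberField L] in
/-- Over a quadratic `L = K ⊕ K θ` with `θ² ∈ K`: a non-trivial `σ ∈ Aut(L/K)` negates `θ`. [folklore] -/
private theorem apply_eq_neg_of_ne_one {θ : L} {c : K} (hθ : θ ^ 2 = algebraMap K L c)
    (hL : ∀ y : L, ∃ a b : K, y = algebraMap K L a + algebraMap K L b * θ) {σ : L ≃ₐ[K] L}
    (hσ : σ ≠ 1) : σ θ = -θ := by
  have h2 : (σ θ) ^ 2 = θ ^ 2 := by rw [← map_pow, hθ, AlgEquiv.commutes]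
  rcases sq_eq_sq_iff_eq_or_eq_neg.mp h2 with h | h
  · exfalso
    apply hσ
    ext y
    obtain ⟨a, b, rfl⟩ := hL y
    rw [map_add, map_mul, AlgEquiv.commutes, AlgEquiv.commutes, h, AlgEquiv.one_apply]
  · exact h

omit [W.IsElliptic] in
/-- `[L : K] = 2 ⟹ Aut(L/K)` has an element `≠ 1` (the extension is Galois of order `2`). [folklore] -/
private theorem exists_ne_one_of_finrank_eq_two (hLK : Module.finrank K L = 2) : ∃ σ : L ≃ₐ[K] L, σ ≠ 1 := by
  haveI : FiniteDimensional K L := Module.finite_of_finrank_pos (by rw [hLK]; exact two_pos)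
  haveI : Algebra.IsQuadraticExtension K L := ⟨hLK⟩
  haveI : IsGalois K L := inferInstance
  have hcard : Nat.card (L ≃ₐ[K] L) = 2 := by rw [IsGalois.card_aut_eq_finrank, hLK]
  haveI : Nontrivial (L ≃ₐ[K] L) := Finite.one_lt_card_iff_nontrivial.mp (by rw [hcard]; exact one_lt_two)
  exact exists_ne 1

/-- **MEMO STUB S2's OUTPUT ON `H₂ = K·F`, modulo the one local binder at the places above `p_F`:
`#Sel_{2^M}(E_L/L) = (#Sel_{2^M}(E_K/K))²`.** For `E = W/ℚ` globally minimal with CM, `2` inert in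
`F = ℚ(√d_F)`, `ρ̄_{E,2}` onto, `∏_p c_p(E)` odd; `K` imaginary quadratic with the Heegner hypothesis for
`N_E`; `L ⊇ K` with `[L : K] = 2` containing `θ`, `θ² = d_F`. DERIVED inside: `θ ∉ K` (`Δ_E = d_F s²` is
not a square in `K`: `not_isSquare_algebraMap_Δ_of_cmInert_two_of_heegner`,
`exists_Δ_eq_cmFieldDiscr_mul_sq_of_cmInert_two`), the involution `σ ≠ 1` of `L/K` with `σ θ = −θ`, the
square root `r = θ s` of `Δ_{E_L}` with `σ r = −r`, `L` totally complex; then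
`natCard_selmer_baseChange_tower_eq_sq_of_descent` (p660127) with `hdesc` discharged by
`mem_selmerGroup_baseChange_of_resTorsion_mem`. The remaining binder `hram` is MEMO §3 (a)'s «p_F-defect»
(unique `2^M`-divisibility of `E(K̄_v)^{Γ_{L̃_w}}` at `v ∣ p_F`; it holds when `E(ℚ_{p_F})[2] = 0`).
[cite: Lang1987, Ch. 10 §4, Remark] [cite: DokchitserDokchitserAnnals2010, Lemma 4.14 (proof)]
[cite: SerreGaloisCohomology1997, I §2.6 (b)] [cite: GrossLMS1991, §1 and §6 Prop. 6.2 (1)] -/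
theorem natCard_selmer_baseChange_tower_eq_sq_of_sq_eq_cmFieldDiscr [W.IsGloballyMinimal] (hCM : W.HasCM)
    (hin : CMInert W 2) (hsurj : W.HasSurjectiveModNGaloisRep 2) (hodd : Odd W.tamagawaProduct)
    (hK : IsImaginaryQuadratic K) (hH : SatisfiesHeegnerHypothesis (W.conductorNorm ℤ) K)
    (hLK : Module.finrank K L = 2) {θ : L} (hθ : θ ^ 2 = algebraMap ℚ L (cmFieldDiscrOfJ W.j)) (M : ℕ)
    (hram : ∀ v : HeightOneSpectrum (𝓞 K), ((cmFieldDiscrOfJ W.j : 𝓞 K)) ∈ v.asIdeal →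
      ∃ (w : HeightOneSpectrum (𝓞 L)) (_ : w.asIdeal.LiesOver v.asIdeal),
        letI : Algebra (v.adicCompletion K) (w.adicCompletion L) :=
          (adicCompletionMap (K := K) L v w).toAlgebra
        (∀ a : localPoints (W.baseChange K) (v.adicCompletion K),
          (∀ g ∈ finGalSubgroup (E := v.adicCompletion K) (w.adicCompletion L), g • a = a) →
            ((2 : ℤ) ^ M) • a = 0 → a = 0) ∧
        (∀ a : localPoints (W.baseChange K) (v.adicCompletion K),
          (∀ g ∈ finGalSubgroup (E := v.adicCompletion K) (w.adicCompletion L), g • a = a) →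
            ∃ b : localPoints (W.baseChange K) (v.adicCompletion K),
              (∀ g ∈ finGalSubgroup (E := v.adicCompletion K) (w.adicCompletion L), g • b = b) ∧
                ((2 : ℤ) ^ M) • b = a)) :
    Nat.card (selmerGroup (W.baseChange L) ((2 : ℤ) ^ M)) =
      Nat.card (selmerGroup (W.baseChange K) ((2 : ℤ) ^ M)) ^ 2 := by
  haveI : FiniteDimensional K L := Module.finite_of_finrank_pos (by rw [hLK]; exact two_pos)
  -- `Δ_E = d_F · s²`
  obtain ⟨-, s, hs⟩ := KolyvaginFrobeniusTwo.exists_Δ_eq_cmFieldDiscr_mul_sq_of_cmInert_two W hCM hin hsurj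
  -- `θ ∉ K`: otherwise `Δ_E = (θ s)²` would be a square in `K`
  have hθK : θ ∉ Set.range (algebraMap K L) := by
    rintro ⟨t, ht⟩
    apply KolyvaginImageTwo.not_isSquare_algebraMap_Δ_of_cmInert_two_of_heegner W hCM hin hsurj K hK hH
    refine ⟨t * algebraMap ℚ K s, (algebraMap K L).injective ?_⟩
    have h1 : algebraMap K L (algebraMap ℚ K W.Δ) = algebraMap ℚ L W.Δ :=
      (IsScalarTower.algebraMap_apply ℚ K L _).symm
    have h2 : algebraMap K L (algebraMap ℚ K s) = algebraMap ℚ L s :=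
      (IsScalarTower.algebraMap_apply ℚ K L _).symm
    rw [h1, map_mul, map_mul, h2, ht, hs, map_mul, map_pow, ← hθ]
    ring
  have hL : ∀ y : L, ∃ a b : K, y = algebraMap K L a + algebraMap K L b * θ :=
    Literature.NumberTheory.QuadraticFields.Quadratic.exists_eq_add_mul hLK hθK
  have hθ' : θ ^ 2 = algebraMap K L (algebraMap ℚ K (cmFieldDiscrOfJ W.j)) := by
    rw [hθ, IsScalarTower.algebraMap_apply ℚ K L]
  -- the involution
  obtain ⟨σ, hσ⟩ := exists_ne_one_of_finrank_eq_two (K := K) (L := L) hLK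
  have hσθ : σ θ = -θ := apply_eq_neg_of_ne_one hθ' hL hσ
  -- the square root of `Δ_{E_L}` moved by `σ`
  have hr : (θ * algebraMap ℚ L s) ^ 2 = (W.baseChange L).Δ := by
    rw [baseChange, map_Δ, hs, map_mul, map_pow, ← hθ]
    ring
  have hσr : σ (θ * algebraMap ℚ L s) = -(θ * algebraMap ℚ L s) := by
    rw [map_mul, hσθ, IsScalarTower.algebraMap_apply ℚ K L, AlgEquiv.commutes, neg_mul]
  -- `L` is totally complex (so is `K`)
  have hLc : ∀ w : InfinitePlace L, w.IsComplex := fun w ↦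
    (InfinitePlace.isReal_or_isComplex w).resolve_left fun hw ↦
      InfinitePlace.not_isReal_iff_isComplex.mpr (hK.2.isComplex _) (hw.comap (algebraMap K L))
  have hF : IsSquare (algebraMap ℚ L (cmFieldDiscrOfJ W.j)) := ⟨θ, by rw [← sq, hθ]⟩
  exact natCard_selmer_baseChange_tower_eq_sq_of_descent_of_isImaginaryQuadratic W hCM hin hsurj hK hLK hLc
    hF hσ hr hσr M fun x hx ↦
      mem_selmerGroup_baseChange_of_resTorsion_mem W hin hodd hK hH hLK hθ hθK M hram hx

end Habitat

end Summit.BirchSwinnertonDyer.Rank1Residual.P2.SelmerDescentAtTwo
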